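import Literature.MathematicalPhysics.QuantumLattice.ReducedBCSTorus
import HarnessLib

/-!
# Route `LiebTwin`, crux `DWavePolarisedDiscordance` (stmt-HubbardSuperconductivity-15314), line `Sketch`:
# the total relative-channel pair weight is `L²` times the Cooper-pair occupancy (helper, `--supports`)

Momentum-space reading of the central quantity of line `Sketch` (card `Ideas/channel-exhaustion-sum-rule.md`):
for the bare relative-coordinate channel fields `Δ_r := Σ_x c_{x↑} c_{x+r,↓}` (`r ∈ (ℤ/L)²`) on the fermionic torus,

* `channelField_eq_sum_pairMode` — `Δ_r = Σ_k χ_{−k}(r) · c_{k↑} c_{−k↓}` (Fourier inversion of both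
  annihilators and orthogonality `Σ_x χ_{k+k'}(x) = L² δ_{k+k'=0}`: only Cooper partners `k' = −k` survive);
* `sum_channelField_conjTranspose_mul_self` — the OPERATOR IDENTITY
  `Σ_r Δ_rᴴ Δ_r = L² · Σ_k b_kᴴ b_k`, `b_k = pairMode k = c_{−k↓} c_{k↑}` (`b_kᴴ b_k = n_{k↑} n_{−k↓}` is the
  occupancy of the Cooper pair `(k↑, −k↓)`): the total zero-pair-momentum relative-channel pair weight counts
  doubly-occupied Cooper partners.

Consequently the leak of line `Sketch` (`4·Leak = Σ_r‖Δ_rφ̃‖² − Σ_r‖Δ_rφ‖²`, landed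
`LiebTwinChannelExhaustion.sum_expect_channelField_twin_sub`) is `(L²/4)·Σ_k [⟨b_kᴴb_k⟩_φ̃ − ⟨b_kᴴb_k⟩_φ]`, and
`stub_leakBound` reads: along ground states the twin counts at most `η·m/(8L²) + o(L²)` more occupied Cooper pairs
than the state. Sources: C. N. Yang, Rev. Mod. Phys. **34** (1962) 694, §4 and PRL **63** (1989) 2144 (pair
operators in momentum space); J. von Delft, D. C. Ralph, Phys. Rep. **345** (2001) 61, §4.2 (`b_k`). Finite Fourier
bookkeeping; no definition, no named fact.
-/

-- the mandated namespace `Summit.<Summit>.<Problem>.Theorems` repeats `HubbardSuperconductivity` (D-0017)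
set_option linter.dupNamespace false

noncomputable section

namespace Summit.HubbardSuperconductivity.HubbardSuperconductivity.Theorems.LiebTwinChannelExhaustion

open Matrix Finset Literature.MathematicalPhysics.QuantumLattice Literature.Probability.LatticeModels
open scoped ComplexConjugate

variable {L : ℕ} [NeZero L]

/-- Fourier coefficient bookkeeping: `Σ_x (w χ_k(x)) (w χ_{k'}(x + r)) = 𝟙{k' = −k} χ_{k'}(r)`
(`w = L^{-1}`, `Σ_x χ_{k+k'}(x) = L² 𝟙{k+k'=0}`). [folklore] -/
theorem sum_fourierWeight_mul_torusChar_mul (k k' r : TorusSite 2 L) :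
    ∑ x : TorusSite 2 L, torusFourierWeight 2 L * torusChar k x * (torusFourierWeight 2 L * torusChar k' (x + r)) =
      if k' = -k then torusChar k' r else 0 := by
  have h : ∀ x : TorusSite 2 L,
      torusFourierWeight 2 L * torusChar k x * (torusFourierWeight 2 L * torusChar k' (x + r)) =
        torusFourierWeight 2 L * torusFourierWeight 2 L * torusChar k' r * torusChar (k + k') x := by
    intro x
    rw [torusChar_add_right, torusChar_comm (k + k') x, torusChar_add_right x k k', torusChar_comm x k,
      torusChar_comm x k']
    ring
  simp_rw [h]
  rw [← Finset.mul_sum, sum_torusChar_right]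
  have hiff : k + k' = 0 ↔ k' = -k := by
    constructor
    · intro h0; exact eq_neg_of_add_eq_zero_right h0
    · intro h0; rw [h0, add_neg_cancel]
  by_cases hk : k' = -k
  · rw [if_pos (hiff.2 hk), if_pos hk,
      show torusFourierWeight 2 L * torusFourierWeight 2 L * torusChar k' r * (L : ℂ) ^ 2 =
        torusChar k' r * (torusFourierWeight 2 L * torusFourierWeight 2 L * (L : ℂ) ^ 2) by ring,
      torusFourierWeight_mul_self_mul_pow, mul_one]
  · rw [if_neg (fun h0 => hk (hiff.1 h0)), if_neg hk, mul_zero]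

/-- **The channel field in momentum space**: `Δ_r = Σ_x c_{x↑} c_{x+r,↓} = Σ_k χ_{−k}(r) · c_{k↑} c_{−k↓}`
(only Cooper partners survive the sum over the pair position). Yang, Rev. Mod. Phys. 34 (1962) 694, §4. [folklore] -/
theorem channelField_eq_sum_pairMode (r : TorusSite 2 L) :
    (∑ x : TorusSite 2 L, annihilation (orb (FermionTorus.ofTorusSite x) 0) *
        annihilation (orb (FermionTorus.ofTorusSite (x + r)) 1) :
        Matrix (Finset (Orb (FermionTorus 2 L))) (Finset (Orb (FermionTorus 2 L))) ℂ) =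
      ∑ k : TorusSite 2 L, torusChar (-k) r • (momentumAnnihilation k 0 * momentumAnnihilation (-k) 1) := by
  have hx : ∀ x : TorusSite 2 L, annihilation (orb (FermionTorus.ofTorusSite x) (0 : Fin 2)) =
      ∑ k : TorusSite 2 L, (torusFourierWeight 2 L * torusChar k x) • momentumAnnihilation k 0 := by
    intro x
    rw [annihilation_orb_eq_sum_momentumAnnihilation, FermionTorus.toTorusSite_ofTorusSite]
  have hy : ∀ x : TorusSite 2 L, annihilation (orb (FermionTorus.ofTorusSite (x + r)) (1 : Fin 2)) =
      ∑ k : TorusSite 2 L, (torusFourierWeight 2 L * torusChar k (x + r)) • momentumAnnihilation k 1 := by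
    intro x
    rw [annihilation_orb_eq_sum_momentumAnnihilation, FermionTorus.toTorusSite_ofTorusSite]
  simp_rw [hx, hy, Finset.sum_mul, Finset.mul_sum, smul_mul_smul_comm]
  -- Σ_x Σ_k Σ_k' ↦ Σ_k Σ_k' Σ_x, then the coefficient sum
  rw [Finset.sum_comm]
  refine Finset.sum_congr rfl fun k _ => ?_
  rw [Finset.sum_comm]
  simp_rw [← Finset.sum_smul, sum_fourierWeight_mul_torusChar_mul, ite_smul, zero_smul]
  rw [Finset.sum_ite_eq' Finset.univ (-k)]
  simp

/-- The adjoint channel field: `Δ_rᴴ = Σ_k conj χ_{−k}(r) · (c_{k↑} c_{−k↓})ᴴ`. [folklore] -/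
theorem channelField_conjTranspose_eq (r : TorusSite 2 L) :
    (∑ x : TorusSite 2 L, annihilation (orb (FermionTorus.ofTorusSite x) 0) *
        annihilation (orb (FermionTorus.ofTorusSite (x + r)) 1) :
        Matrix (Finset (Orb (FermionTorus 2 L))) (Finset (Orb (FermionTorus 2 L))) ℂ)ᴴ =
      ∑ k : TorusSite 2 L, conj (torusChar (-k) r) •
        (momentumAnnihilation k 0 * momentumAnnihilation (-k) 1)ᴴ := by
  rw [channelField_eq_sum_pairMode, conjTranspose_sum]
  refine Finset.sum_congr rfl fun k _ => ?_
  rw [conjTranspose_smul, Complex.star_def]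

/-- `c_{k↑} c_{−k↓} = −b_k` squared away: `(c_{k↑}c_{−k↓})ᴴ (c_{k↑}c_{−k↓}) = b_kᴴ b_k`, `b_k = pairMode k`. [folklore] -/
theorem cooperPair_conjTranspose_mul_self (k : TorusSite 2 L) :
    (momentumAnnihilation k 0 * momentumAnnihilation (-k) 1 :
        Matrix (Finset (Orb (FermionTorus 2 L))) (Finset (Orb (FermionTorus 2 L))) ℂ)ᴴ *
        (momentumAnnihilation k 0 * momentumAnnihilation (-k) 1) =
      (pairMode k)ᴴ * pairMode k := by
  rw [momentumAnnihilation_mul_eq_neg k (-k) 0 1, ← pairMode, conjTranspose_neg, neg_mul_neg]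

/-- **Total relative-channel pair weight = `L²` × Cooper-pair occupancy** (operator identity on Fock space):
`Σ_r Δ_rᴴ Δ_r = L² · Σ_k b_kᴴ b_k`, `Δ_r = Σ_x c_{x↑} c_{x+r,↓}`, `b_k = c_{−k↓} c_{k↑}` (orthogonality of the
characters in the relative coordinate `r`). Yang, Rev. Mod. Phys. 34 (1962) 694, §4; von Delft–Ralph, Phys. Rep. 345
(2001) 61, §4.2. [folklore] -/
theorem sum_channelField_conjTranspose_mul_self :
    ∑ r : TorusSite 2 L,
        (∑ x : TorusSite 2 L, annihilation (orb (FermionTorus.ofTorusSite x) 0) *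
            annihilation (orb (FermionTorus.ofTorusSite (x + r)) 1) :
            Matrix (Finset (Orb (FermionTorus 2 L))) (Finset (Orb (FermionTorus 2 L))) ℂ)ᴴ *
          (∑ x : TorusSite 2 L, annihilation (orb (FermionTorus.ofTorusSite x) 0) *
            annihilation (orb (FermionTorus.ofTorusSite (x + r)) 1)) =
      ((L : ℂ) ^ 2) • ∑ k : TorusSite 2 L, (pairMode k)ᴴ * pairMode k := by
  simp_rw [channelField_conjTranspose_eq, channelField_eq_sum_pairMode, Finset.sum_mul, Finset.mul_sum,
    smul_mul_smul_comm]
  -- Σ_r Σ_k Σ_k' ↦ Σ_k Σ_k' Σ_r and orthogonality in r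
  rw [Finset.sum_comm, Finset.smul_sum]
  refine Finset.sum_congr rfl fun k _ => ?_
  rw [Finset.sum_comm]
  have horth : ∀ k' : TorusSite 2 L,
      ∑ r : TorusSite 2 L, conj (torusChar (-k) r) * torusChar (-k') r = if k = k' then (L : ℂ) ^ 2 else 0 := by
    intro k'
    have h1 : ∀ r : TorusSite 2 L, conj (torusChar (-k) r) * torusChar (-k') r = torusChar (-k' - -k) r := by
      intro r
      rw [torusChar_sub_left, mul_comm]
    simp_rw [h1]
    rw [sum_torusChar_right]
    have hiff : -k' - -k = 0 ↔ k = k' := by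
      rw [sub_eq_zero, neg_inj, eq_comm]
    simp only [hiff]
  simp_rw [← Finset.sum_smul, horth, ite_smul, zero_smul]
  rw [Finset.sum_ite_eq Finset.univ k, if_pos (Finset.mem_univ k), cooperPair_conjTranspose_mul_self]

/-- **STUB `stub_cooperPairWeight`** of crux `DWavePolarisedDiscordance` (stmt-HubbardSuperconductivity-15314), line `Sketch`
(registered helper): on every fermionic torus `(ℤ/L)²`, `Σ_r Δ_rᴴ Δ_r = L² · Σ_k b_kᴴ b_k` — the total relative-channel
pair weight is `L²` times the Cooper-pair occupancy. Yang, Rev. Mod. Phys. 34 (1962) 694, §4. [folklore] -/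
theorem stub_cooperPairWeight :
    open Literature.MathematicalPhysics.QuantumLattice Literature.Probability.LatticeModels in
    ∀ (L : ℕ) [NeZero L],
      ∑ r : TorusSite 2 L,
          (∑ x : TorusSite 2 L, annihilation (orb (FermionTorus.ofTorusSite x) 0) *
              annihilation (orb (FermionTorus.ofTorusSite (x + r)) 1) :
              Matrix (Finset (Orb (FermionTorus 2 L))) (Finset (Orb (FermionTorus 2 L))) ℂ)ᴴ *
            (∑ x : TorusSite 2 L, annihilation (orb (FermionTorus.ofTorusSite x) 0) *
              annihilation (orb (FermionTorus.ofTorusSite (x + r)) 1)) =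
        ((L : ℂ) ^ 2) • ∑ k : TorusSite 2 L, (pairMode k)ᴴ * pairMode k :=
  fun _ _ => sum_channelField_conjTranspose_mul_self

end Summit.HubbardSuperconductivity.HubbardSuperconductivity.Theorems.LiebTwinChannelExhaustion

end
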